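import Summits.CriticalPhenomena.CardyFormulaZ2.Theses.CardySelfDualSegment
import Summits.CriticalPhenomena.CardyFormulaZ2.Theorems.RectilinearCardy.Negative.RectilinearCardyReductions
import Literature.Probability.Percolation.CornerPercolation
import Literature.Probability.Percolation.QuadCrossingSquareModel
import Literature.Probability.RandomPlanarGeometry.ModulusSymmetry
import Literature.Barriers.CriticalPhenomena.EmbeddingModulusUniquenessProofs
import Literature.Probability.LatticeModels.TriangularLatticeProofs

/-!
# `SegmentClosed` (crux stmt-CriticalPhenomena-5473): squares-only moduli confinement fails

Negative-knowledge lemmas extracted from the standing disprover's work file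
`Cruxes/SegmentClosed/Disproof.lean` (refuter `cdisprove`, 2026-08-16), sorry-free, for the lead,
ideators and planners of the crux to IMPORT.

The picked line `Sketch` (lead `prover-line-stmt-CriticalPhenomena-5473-0`) proves the crux from a
MODULI CONFINEMENT stub: a shear parameter `β ∈ ℍ` for which the crude `M_t`-crossing probabilities
of ALL pre-sheared boxes `φ_β((0,w)×(0,h))` converge to the Cardy value of the unsheared box must lie
in a fixed compact `K ⊆ ℍ`. This file records, as checked theorems, why the stub must consume test
boxes of at least two shapes:

* `crossRatio_square_eq_half`, `crossRatio_rhombus_eq_half`: the square `(0,w)²` and every rhombus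
  `φ_β((0,w)²)`, `|β| = 1`, have Cardy cross-ratio `1/2` for EVERY uniformizing datum (reflection in
  the diagonal through `pt 0` and `pt 2`; tree `ConformalRectangle.crossRatio_eq_half_of_antiAffine`).
* `not_squaresOnly_moduli_confinement` (unconditional, pure conformal geometry): the set of shears
  `β ∈ ℍ` under which every square keeps its cross-ratio contains the unit semicircle, which leaves
  every compact subset of `ℍ` (`β = √(1-s²) + is`, `s → 0⁺`); so NO squares-only matching hypothesis
  confines `β`.
* `squaresOnly_confinement_false_of_smirnovBasePoint` (modulo the route's base-point crux
  `SmirnovBasePoint`, stmt-CriticalPhenomena-5474): the squares-only weakening of the lead's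
  `stub_confinement` is FALSE at `t = 0` — by Smirnov's theorem in the route's normalisation
  (`CardyMod 0 ζ`, `ζ = e^{iπ/3}`) the `M_0`-crossing probabilities of the sheared squares
  `φ_β((0,w)²)`, `β = φ_ζ⁻¹(γ)`, `|γ| = 1`, converge to `F(1/2)`, the Cardy value of the square, along a
  family of `β` with `im β → 0`.
* `not_target_of_not_segmentClosed`: for the record, a refutation of the crux refutes the route's
  target (linear universality on the self-dual segment): `Target → G = [0,1] → G closed`.

References: L. V. Ahlfors, *Complex Analysis* (1979), Ch. 4 §6.5 [AhlforsCA1979]; V. Beffara,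
*Is critical 2D percolation universal?* (2008), Prop. 4 [Beffara2008Universal]; S. Smirnov,
C. R. Acad. Sci. 333 (2001) [Smirnov2001].
-/

noncomputable section

namespace Summit.CriticalPhenomena.CardyFormulaZ2.Theorems.SegmentClosed.Negative

open Set Filter Topology Complex Metric
open scoped ComplexConjugate
open UpperHalfPlane (upperHalfPlaneSet)
open Literature.Probability.RandomPlanarGeometry
open Literature.Probability.Percolation (rectQuad rectQuad_carrier cornerCrossingProb)
open Literature.Probability.LatticeModels (triZeta triZeta_re triZeta_im)
open Literature.Barriers.CriticalPhenomena
open Summit.CriticalPhenomena.CardyFormulaZ2.Theorems.RectilinearCardy.Negative (rectQuad_pt)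
open Summit.CriticalPhenomena.CardyFormulaZ2.Theses.CardySelfDualSegment (SegmentClosed Target
  SmirnovBasePoint)

/-! ## §1 The square and the rhombi have cross-ratio `1/2` -/

/-- **The square `(0,w)²` (corners marked counterclockwise from `0`) has Cardy cross-ratio `1/2` for
every uniformizing datum**: the reflection `z ↦ i z̄` in the diagonal fixes `pt 0 = 0`, `pt 2 = w + iw`,
swaps `pt 1 = w ↔ pt 3 = iw` and preserves the square. [folklore] -/
theorem crossRatio_square_eq_half {w : ℝ} (hw : 0 < w)
    {φ : ConformalEquiv upperHalfPlaneSet (rectQuad 0 w 0 w hw hw).carrier} {x : Fin 4 → ℝ}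
    (h : (rectQuad 0 w 0 w hw hw).IsUniformizing φ x) : crossRatio x = 1 / 2 := by
  obtain ⟨h0, h1, h2, h3⟩ := rectQuad_pt hw hw (x₀ := 0) (y₀ := 0)
  refine ConformalRectangle.crossRatio_eq_half_of_antiAffine (rectQuad 0 w 0 w hw hw) (u := I)
    (v := 0) (by simp) (by simp) ?_ ?_ ?_ ?_ h
  · intro z hz
    rw [rectQuad_carrier, Complex.mem_reProdIm] at hz ⊢
    simp only [antiAffine, add_zero, mul_re, I_re, conj_re, zero_mul, I_im, conj_im, one_mul,
      zero_sub, neg_neg, mul_im, zero_add] at hz ⊢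
    exact ⟨hz.2, hz.1⟩
  · rw [h0]; apply Complex.ext <;> simp [antiAffine]
  · rw [h2]; apply Complex.ext <;> simp [antiAffine]
  · rw [h1, h3]; apply Complex.ext <;> simp [antiAffine]

/-- **Every rhombus `φ_β((0,w)²)`, `|β| = 1`, `im β > 0` (vertices `0, w, w(1+β), wβ`, marked in this
order) has Cardy cross-ratio `1/2` for every uniformizing datum**: the reflection `z ↦ β z̄` in the
diagonal through `0` and `1 + β` fixes `pt 0`, `pt 2`, swaps `pt 1 ↔ pt 3` and preserves the rhombus
(`β \overline{(s + βt)} = t + βs` as `β β̄ = 1`). This is the "by symmetry" step of Beffara (2008),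
proof of Prop. 4. [cite: Beffara2008Universal, Proposition 4 (proof)] -/
theorem crossRatio_rhombus_eq_half {β : ℂ} (hβ : 0 < β.im) (hβ1 : ‖β‖ = 1) {w : ℝ} (hw : 0 < w)
    {φ : ConformalEquiv upperHalfPlaneSet
      ((rectQuad 0 w 0 w hw hw).map (shearHomeomorph β hβ.ne')).carrier}
    {x : Fin 4 → ℝ} (h : ((rectQuad 0 w 0 w hw hw).map (shearHomeomorph β hβ.ne')).IsUniformizing φ x) :
    crossRatio x = 1 / 2 := by
  obtain ⟨h0, h1, h2, h3⟩ := rectQuad_pt hw hw (x₀ := 0) (y₀ := 0)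
  have hbb : β * conj β = 1 := by
    rw [Complex.mul_conj, Complex.normSq_eq_norm_sq, hβ1]; simp
  refine ConformalRectangle.crossRatio_eq_half_of_antiAffine _ (u := β) (v := 0) hβ1 (by simp)
    ?_ ?_ ?_ ?_ h
  · intro z hz
    rw [MarkedDomain.carrier_map, coe_shearHomeomorph, rectQuad_carrier] at hz ⊢
    obtain ⟨p, hp, rfl⟩ := hz
    rw [Complex.mem_reProdIm] at hp
    refine ⟨⟨p.im, p.re⟩, ?_, ?_⟩
    · rw [Complex.mem_reProdIm]; exact ⟨hp.2, hp.1⟩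
    · simp only [antiAffine, moduliShear, map_add, map_mul, Complex.conj_ofReal, add_zero]
      linear_combination (-(p.im : ℂ)) * hbb
  · rw [MarkedDomain.pt_map, coe_shearHomeomorph, h0]
    simp [antiAffine, moduliShear]
  · rw [MarkedDomain.pt_map, coe_shearHomeomorph, h2]
    simp only [antiAffine, moduliShear, map_add, map_mul, Complex.conj_ofReal, add_zero]
    linear_combination ((w : ℂ)) * hbb
  · rw [MarkedDomain.pt_map, MarkedDomain.pt_map, coe_shearHomeomorph, h1, h3]
    simp [antiAffine, moduliShear]

/-- The point `√(1 - s²) + i s` of the unit circle (`0 ≤ s ≤ 1`). [folklore] -/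
theorem norm_circlePt {s : ℝ} (h0 : 0 ≤ s) (h1 : s ≤ 1) :
    ‖(⟨Real.sqrt (1 - s ^ 2), s⟩ : ℂ)‖ = 1 := by
  have h1s : 0 ≤ 1 - s ^ 2 := by nlinarith
  rw [Complex.norm_def, Complex.normSq_mk, Real.mul_self_sqrt h1s,
    show 1 - s ^ 2 + s * s = 1 by ring, Real.sqrt_one]

/-! ## §2 Squares alone never confine the shear parameter (unconditional) -/

/-- **No squares-only moduli-matching hypothesis confines the shear.** There is NO compact
`K ⊆ ℍ` containing every `β ∈ ℍ` under which all squares `(0,w)²` keep their Cardy cross-ratio: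
every `β` on the unit semicircle qualifies (square and rhombus both have cross-ratio `1/2`,
`crossRatio_square_eq_half`, `crossRatio_rhombus_eq_half`), and `β_s = √(1-s²) + is → 1 ∈ ∂ℍ` as
`s → 0⁺` leaves every compact subset of `ℍ` (`im` attains a positive minimum on `K`). Hence the
confinement half of the crux's line must test boxes of a second shape (the lead's `stub_confinement`
does: all `(0,w)×(0,h)`); this is the tree form of the crux-ideator's remark "single-box properness is
FALSE (rhombus)". [folklore] -/
theorem not_squaresOnly_moduli_confinement :
    ¬ ∃ K : Set ℂ, IsCompact K ∧ K ⊆ {β : ℂ | 0 < β.im} ∧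
      ∀ (β : ℂ) (hβ : 0 < β.im),
        (∀ (w : ℝ) (hw : 0 < w)
          (φ : ConformalEquiv upperHalfPlaneSet (rectQuad 0 w 0 w hw hw).carrier) (x : Fin 4 → ℝ)
          (ψ : ConformalEquiv upperHalfPlaneSet
            ((rectQuad 0 w 0 w hw hw).map (shearHomeomorph β hβ.ne')).carrier) (y : Fin 4 → ℝ),
          (rectQuad 0 w 0 w hw hw).IsUniformizing φ x →
          ((rectQuad 0 w 0 w hw hw).map (shearHomeomorph β hβ.ne')).IsUniformizing ψ y →
          crossRatio y = crossRatio x) → β ∈ K := by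
  rintro ⟨K, hK, hKH, hconf⟩
  -- every point of the open unit upper semicircle satisfies the matching hypothesis
  have hcirc : ∀ s : ℝ, 0 < s → s < 1 → (⟨Real.sqrt (1 - s ^ 2), s⟩ : ℂ) ∈ K := by
    intro s hs0 hs1
    have hn : ‖(⟨Real.sqrt (1 - s ^ 2), s⟩ : ℂ)‖ = 1 := norm_circlePt hs0.le hs1.le
    exact hconf _ hs0 fun w hw φ x ψ y hx hy => by
      rw [crossRatio_square_eq_half hw hx, crossRatio_rhombus_eq_half hs0 hn hw hy]
  have hne : K.Nonempty := ⟨_, hcirc (1 / 2) (by norm_num) (by norm_num)⟩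
  obtain ⟨β₀, hβ₀K, hmin⟩ := hK.exists_isMinOn hne Complex.continuous_im.continuousOn
  have hm : 0 < β₀.im := hKH hβ₀K
  have hs0 : 0 < min (1 / 2 : ℝ) (β₀.im / 2) := lt_min (by norm_num) (by linarith)
  have hs1 : min (1 / 2 : ℝ) (β₀.im / 2) < 1 := (min_le_left _ _).trans_lt (by norm_num)
  have hle : β₀.im ≤ min (1 / 2 : ℝ) (β₀.im / 2) := (isMinOn_iff.1 hmin) _ (hcirc _ hs0 hs1)
  linarith [min_le_right (1 / 2 : ℝ) (β₀.im / 2)]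

/-! ## §3 The squares-only confinement stub is false at Smirnov's point (modulo `SmirnovBasePoint`) -/

/-- `φ_ζ` maps `β_s = (√(1-s²) - s/√3) + i·2s/√3` to the unit-circle point `√(1-s²) + is`
(`ζ = e^{iπ/3} = 1/2 + i√3/2`, `φ_ζ(x + iy) = x + ζ y`). [folklore] -/
theorem moduliShear_triZeta_pullbackPt (s : ℝ) :
    moduliShear triZeta (⟨Real.sqrt (1 - s ^ 2) - s / Real.sqrt 3, 2 * s / Real.sqrt 3⟩ : ℂ) =
      ⟨Real.sqrt (1 - s ^ 2), s⟩ := by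
  have h3 : Real.sqrt 3 ≠ 0 := by positivity
  apply Complex.ext
  · simp [moduliShear, triZeta_re, triZeta_im]
    field_simp
    ring
  · simp [moduliShear, triZeta_re, triZeta_im, h3]

/-- **The squares-only weakening of the confinement stub is FALSE, given the route's base point.**
Assume `SmirnovBasePoint` (stmt-CriticalPhenomena-5474: `CardyMod 0 ζ`, Smirnov's theorem for the
corner model `M_0` ≅ site percolation on `𝕋`, read through the shear `φ_ζ`; provable in kind, open in
the tree). Then there is NO compact `K ⊆ ℍ` such that every `(t, β)` for which the crude
`M_t`-crossing probabilities of all sheared SQUARES `φ_β((0,w)²)` converge to the Cardy value of the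
square has `β ∈ K`: at `t = 0`, for `β_s = φ_ζ⁻¹(γ_s)`, `γ_s = √(1-s²) + is`, the base point gives
convergence to `F(η(φ_ζ φ_{β_s}((0,w)²))) = F(η(rhombus γ_s)) = F(1/2) = F(η(square))`, while
`im β_s = 2s/√3 → 0`. So `stub_confinement` of line `Sketch` genuinely needs its non-square test
boxes; any reshaping that keeps only `w = h` is refuted here. [cite: Smirnov2001, Théorème 1] -/
theorem squaresOnly_confinement_false_of_smirnovBasePoint (hB : SmirnovBasePoint) :
    ¬ ∃ K : Set ℂ, IsCompact K ∧ K ⊆ {β : ℂ | 0 < β.im} ∧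
      ∀ (t : unitInterval) (β : ℂ) (hβ : 0 < β.im),
        (∀ (w : ℝ) (hw : 0 < w)
          (φ : ConformalEquiv upperHalfPlaneSet (rectQuad 0 w 0 w hw hw).carrier) (x : Fin 4 → ℝ),
          (rectQuad 0 w 0 w hw hw).IsUniformizing φ x →
          Tendsto (cornerCrossingProb t ((rectQuad 0 w 0 w hw hw).map (shearHomeomorph β hβ.ne')))
            (𝓝[>] 0) (𝓝 (cardyFunction (crossRatio x)))) → β ∈ K := by
  -- the base point, unfolded over the tree's `cornerCrossingProb` (literally the route's `P`)
  have hB' : ∀ (R R' : ConformalRectangle) (ψ : ConformalEquiv upperHalfPlaneSet R.carrier)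
      (y : Fin 4 → ℝ), R.carrier = moduliShear triZeta '' R'.carrier →
      (∀ i, R.pt i = moduliShear triZeta (R'.pt i)) → R.IsUniformizing ψ y →
      Tendsto (cornerCrossingProb 0 R') (𝓝[>] 0) (𝓝 (cardyFunction (crossRatio y))) := hB
  rintro ⟨K, hK, hKH, hconf⟩
  have hmem : ∀ s : ℝ, 0 < s → s < 1 →
      (⟨Real.sqrt (1 - s ^ 2) - s / Real.sqrt 3, 2 * s / Real.sqrt 3⟩ : ℂ) ∈ K := by
    intro s hs0 hs1
    have hβim : 0 < (⟨Real.sqrt (1 - s ^ 2) - s / Real.sqrt 3, 2 * s / Real.sqrt 3⟩ : ℂ).im := by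
      show 0 < 2 * s / Real.sqrt 3
      positivity
    have hγim : (0 : ℝ) < (⟨Real.sqrt (1 - s ^ 2), s⟩ : ℂ).im := hs0
    have hγn : ‖(⟨Real.sqrt (1 - s ^ 2), s⟩ : ℂ)‖ = 1 := norm_circlePt hs0.le hs1.le
    refine hconf 0 _ hβim fun w hw φ x hx => ?_
    obtain ⟨ψ, y, hy⟩ := MarkedDomain.exists_isUniformizing_holds
      ((rectQuad 0 w 0 w hw hw).map (shearHomeomorph _ hγim.ne'))
    have hlim := hB' _ ((rectQuad 0 w 0 w hw hw).map (shearHomeomorph _ hβim.ne')) ψ y ?_ ?_ hy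
    · rw [crossRatio_rhombus_eq_half hγim hγn hw hy] at hlim
      rwa [crossRatio_square_eq_half hw hx]
    · rw [MarkedDomain.carrier_map, MarkedDomain.carrier_map, coe_shearHomeomorph,
        coe_shearHomeomorph, Set.image_image]
      exact Set.image_congr' fun z => by rw [moduliShear_moduliShear, moduliShear_triZeta_pullbackPt]
    · intro i
      rw [MarkedDomain.pt_map, MarkedDomain.pt_map, coe_shearHomeomorph, coe_shearHomeomorph,
        moduliShear_moduliShear, moduliShear_triZeta_pullbackPt]
  have hne : K.Nonempty := ⟨_, hmem (1 / 2) (by norm_num) (by norm_num)⟩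
  obtain ⟨β₀, hβ₀K, hmin⟩ := hK.exists_isMinOn hne Complex.continuous_im.continuousOn
  have hm : 0 < β₀.im := hKH hβ₀K
  have hs0 : 0 < min (1 / 2 : ℝ) (β₀.im / 2) := lt_min (by norm_num) (by linarith)
  have hs1 : min (1 / 2 : ℝ) (β₀.im / 2) < 1 := (min_le_left _ _).trans_lt (by norm_num)
  have hle : β₀.im ≤ 2 * min (1 / 2 : ℝ) (β₀.im / 2) / Real.sqrt 3 :=
    (isMinOn_iff.1 hmin) _ (hmem _ hs0 hs1)
  have h3 : (1 : ℝ) < Real.sqrt 3 := (Real.lt_sqrt zero_le_one).2 (by norm_num)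
  have h3' : (0 : ℝ) < Real.sqrt 3 := by positivity
  rw [le_div_iff₀ h3'] at hle
  nlinarith [min_le_right (1 / 2 : ℝ) (β₀.im / 2)]

/-! ## §4 For the record: a refutation of the crux refutes the route's target -/

/-- **`¬ SegmentClosed → ¬ Target`.** The route's target (linear universality along the whole
self-dual segment) says `G = [0,1]`, which is closed; so the crux `SegmentClosed`
(`UBC → UM → IsClosed G`) follows from `Target` with both hypotheses unused, and any refutation of the
crux is a refutation of Langlands–Pouliot–Saint-Aubin linear universality for the corner family — in
particular no `SegmentClosed`-without-a-hypothesis statement can be refuted short of that. [folklore] -/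
theorem not_target_of_not_segmentClosed (h : ¬ SegmentClosed) : ¬ Target := fun hT =>
  h (by
    intro _ _
    convert isClosed_univ
    exact Set.eq_univ_of_forall fun t => hT t)

end Summit.CriticalPhenomena.CardyFormulaZ2.Theorems.SegmentClosed.Negative

end
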